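import Summits.QuantumAdvantage.QuantumAdvantage.Theorems.CubicForrelationNearExactIsExactTwelvePartnerRadical

/-!
# Crux `CubicForrelation.NearExactIsExact` (stmt-QuantumAdvantage-14043) — E1280-even, R4 branch, descendant `x₁q₄` (`HL 2`): the
  RADICAL VECTOR `u = α e_{z₅} + β e_{z₆} + y e_{y_a}`

Certificate seat `b2b-cforr-cert` (gen 43).  HONEST FRAMING: kernel-checked linear algebra over `𝔽₂` (standard axioms) — the last step of the
descendant `t̄₇ = x₁q₄` (E1280-HANDPROOFS §2.1 "RADICAL", here WITHOUT the shear and the `y_a`-gauge of R4-PARTNER §1/§6: the gauge term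
`ω ∧ y′` is absorbed by the `e_{y_a}`-component of the radical vector).  In the adapted R4 frame (`y_a = e₀`, `v_t = e_{1+t}`, `z_j = e_{5+j}`;
`d(y_a,·,·) = v₀v₁ + v₂v₃` by `hF`) suppose, for some `(α, β) ≠ (0, 0)` and `y`: `d` vanishes on `z_m × z × z` and on `z_m × v × z` for
`m = 5, 6`, and `α·d(z₅,v_a,v_b) + β·d(z₆,v_a,v_b) + y·d(y_a,v_a,v_b) = 0` for all `a, b`.  Then `u = α e_{z₅} + β e_{z₆} + y e_{y_a} ≠ 0`
satisfies `ι_u d = 0`, contradicting the partner equations (`tpr_radical_obstruction`).  …CubicFormR4LevelTwo supplies these hypotheses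
from the exact cells.  Nothing about `θ₁₂`; NOT summit progress.

References: this seat lineage (g39 HANDPROOFS §0.2/§2.1).  Axioms: the standard three.
-/

set_option linter.dupNamespace false -- D-0017: single-problem summit ⇒ `QuantumAdvantage.QuantumAdvantage` by design

namespace Summit.QuantumAdvantage.QuantumAdvantage.Theorems.CubicForrelation.NearExactIsExact

open Finset

/-- **The radical vector of descendant `x₁q₄`.**  See the module docstring. [this work] -/
theorem tq4_radical (c d : Fin (5 + 7) → Fin (5 + 7) → Fin (5 + 7) → ZMod 2)
    (hdc : ∀ φ j k, d j φ k = d φ j k) (hds : ∀ φ j k, d φ k j = d φ j k)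
    (hpair : ∀ p φ, (∑ j, ∑ k, (if j < k then c p j k * d φ j k else 0)) = if p = φ then 1 else 0)
    (hF : ∀ j k, d (Fin.castAdd 7 (0 : Fin 5)) j k =
      (if (j = Fin.castAdd 7 (1 : Fin 5) ∧ k = Fin.castAdd 7 (2 : Fin 5)) ∨ (j = Fin.castAdd 7 (2 : Fin 5) ∧ k = Fin.castAdd 7 (1 : Fin 5)) then 1 else 0) +
      (if (j = Fin.castAdd 7 (3 : Fin 5) ∧ k = Fin.castAdd 7 (4 : Fin 5)) ∨ (j = Fin.castAdd 7 (4 : Fin 5) ∧ k = Fin.castAdd 7 (3 : Fin 5)) then 1 else 0))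
    (α β y : ZMod 2) (hαβ : α ≠ 0 ∨ β ≠ 0)
    (hz5 : ∀ j k : Fin 7, d (Fin.natAdd 5 (5 : Fin 7)) (Fin.natAdd 5 j) (Fin.natAdd 5 k) = 0)
    (hz6 : ∀ j k : Fin 7, d (Fin.natAdd 5 (6 : Fin 7)) (Fin.natAdd 5 j) (Fin.natAdd 5 k) = 0)
    (hm5 : ∀ (t : Fin 4) (k : Fin 7), d (Fin.natAdd 5 (5 : Fin 7)) (Fin.castAdd 7 t.succ) (Fin.natAdd 5 k) = 0)
    (hm6 : ∀ (t : Fin 4) (k : Fin 7), d (Fin.natAdd 5 (6 : Fin 7)) (Fin.castAdd 7 t.succ) (Fin.natAdd 5 k) = 0)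
    (hvv : ∀ a b : Fin 4, α * d (Fin.natAdd 5 (5 : Fin 7)) (Fin.castAdd 7 a.succ) (Fin.castAdd 7 b.succ) +
        β * d (Fin.natAdd 5 (6 : Fin 7)) (Fin.castAdd 7 a.succ) (Fin.castAdd 7 b.succ) +
        y * d (Fin.castAdd 7 (0 : Fin 5)) (Fin.castAdd 7 a.succ) (Fin.castAdd 7 b.succ) = 0) : False := by
  -- the `y_a`-slice vanishes as soon as one argument is a `z`-coordinate or `y_a` itself
  have hne : ∀ (i : Fin 5) (k : Fin 7), (Fin.natAdd 5 k : Fin (5 + 7)) ≠ Fin.castAdd 7 i := by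
    intro i k e
    have := congrArg Fin.val e
    simp only [Fin.val_natAdd, Fin.val_castAdd] at this
    omega
  have hFz : ∀ (j : Fin (5 + 7)) (k : Fin 7), d (Fin.castAdd 7 (0 : Fin 5)) j (Fin.natAdd 5 k) = 0 := by
    intro j k
    rw [hF, if_neg (by rintro (⟨-, h⟩ | ⟨-, h⟩) <;> exact hne _ _ h), if_neg (by rintro (⟨-, h⟩ | ⟨-, h⟩) <;> exact hne _ _ h),
      add_zero]
  have hFz' : ∀ (j : Fin (5 + 7)) (k : Fin 7), d (Fin.castAdd 7 (0 : Fin 5)) (Fin.natAdd 5 k) j = 0 := by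
    intro j k; rw [hds]; exact hFz j k
  have hFa : ∀ j : Fin (5 + 7), d (Fin.castAdd 7 (0 : Fin 5)) (Fin.castAdd 7 (0 : Fin 5)) j = 0 := by
    intro j
    rw [hF, if_neg (by rintro (⟨h, -⟩ | ⟨h, -⟩) <;> exact absurd (congrArg Fin.val h) (by decide)),
      if_neg (by rintro (⟨h, -⟩ | ⟨h, -⟩) <;> exact absurd (congrArg Fin.val h) (by decide)), add_zero]
  have hFa' : ∀ j : Fin (5 + 7), d (Fin.castAdd 7 (0 : Fin 5)) j (Fin.castAdd 7 (0 : Fin 5)) = 0 := by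
    intro j; rw [hds]; exact hFa j
  -- `z_m`-slices with a `y_a` argument vanish (symmetry + `hF`)
  have hzy : ∀ (m : Fin 7) (j : Fin (5 + 7)), d (Fin.natAdd 5 m) (Fin.castAdd 7 (0 : Fin 5)) j = 0 := by
    intro m j; rw [hdc]; exact hFz' j m
  have hzy' : ∀ (m : Fin 7) (j : Fin (5 + 7)), d (Fin.natAdd 5 m) j (Fin.castAdd 7 (0 : Fin 5)) = 0 := by
    intro m j; rw [hds]; exact hzy m j
  -- the combination `α·d(z₅,j,k) + β·d(z₆,j,k) + y·d(y_a,j,k)` vanishes for all `j, k`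
  have hcomb : ∀ j k : Fin (5 + 7), α * d (Fin.natAdd 5 (5 : Fin 7)) j k + β * d (Fin.natAdd 5 (6 : Fin 7)) j k +
      y * d (Fin.castAdd 7 (0 : Fin 5)) j k = 0 := by
    intro j k
    refine Fin.addCases (fun a => ?_) (fun j' => ?_) j
    · refine Fin.addCases (fun b => ?_) (fun k' => ?_) k
      · -- `v × v` block (with `y_a = v`-index `0`)
        refine Fin.cases ?_ (fun t => ?_) a
        · rw [hzy, hzy, hFa]; ring
        · refine Fin.cases ?_ (fun s => ?_) b
          · rw [hzy', hzy', hFa']; ring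
          · exact hvv t s
      · refine Fin.cases ?_ (fun t => ?_) a
        · rw [hzy, hzy, hFa]; ring
        · rw [hm5, hm6, hFz]; ring
    · refine Fin.addCases (fun b => ?_) (fun k' => ?_) k
      · refine Fin.cases ?_ (fun s => ?_) b
        · rw [hzy', hzy', hFa']; ring
        · rw [hds (Fin.natAdd 5 (5 : Fin 7)) (Fin.castAdd 7 s.succ) (Fin.natAdd 5 j'),
            hds (Fin.natAdd 5 (6 : Fin 7)) (Fin.castAdd 7 s.succ) (Fin.natAdd 5 j'),
            hds (Fin.castAdd 7 (0 : Fin 5)) (Fin.castAdd 7 s.succ) (Fin.natAdd 5 j'), hm5, hm6, hFz]; ring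
      · rw [hz5, hz6, hFz]; ring
  -- the radical vector
  let u : Fin (5 + 7) → ZMod 2 := fun φ =>
    (if φ = Fin.natAdd 5 (5 : Fin 7) then α else 0) + (if φ = Fin.natAdd 5 (6 : Fin 7) then β else 0) +
      (if φ = Fin.castAdd 7 (0 : Fin 5) then y else 0)
  have hsum : ∀ j k, (∑ φ, u φ * d φ j k) = α * d (Fin.natAdd 5 (5 : Fin 7)) j k + β * d (Fin.natAdd 5 (6 : Fin 7)) j k +
      y * d (Fin.castAdd 7 (0 : Fin 5)) j k := by
    intro j k
    simp only [u, add_mul, ite_mul, zero_mul, sum_add_distrib, sum_ite_eq', mem_univ, if_true]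
  have hu := tpr_radical_obstruction c d hpair u (fun j k => by rw [hsum]; exact hcomb j k)
  have h5 := congrFun hu (Fin.natAdd 5 (5 : Fin 7))
  have h6 := congrFun hu (Fin.natAdd 5 (6 : Fin 7))
  simp only [u, Pi.zero_apply] at h5 h6
  have e56 : (Fin.natAdd 5 (5 : Fin 7) : Fin (5 + 7)) ≠ Fin.natAdd 5 (6 : Fin 7) := by decide
  have e5y : (Fin.natAdd 5 (5 : Fin 7) : Fin (5 + 7)) ≠ Fin.castAdd 7 (0 : Fin 5) := by decide
  have e6y : (Fin.natAdd 5 (6 : Fin 7) : Fin (5 + 7)) ≠ Fin.castAdd 7 (0 : Fin 5) := by decide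
  simp only [if_true, e56, e5y, if_false, add_zero] at h5
  simp only [e56.symm, if_false, if_true, e6y, zero_add, add_zero] at h6
  rcases hαβ with hα | hβ
  · exact hα h5
  · exact hβ h6

end Summit.QuantumAdvantage.QuantumAdvantage.Theorems.CubicForrelation.NearExactIsExact
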